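import Literature.MathematicalPhysics.QuantumChemistry.OnePositivityFromTwoPositivity
import HarnessLib

/-!
# Ventures/CertifiedQuantumChemistry — Rows/OrbitalRotationCovariance.lean: the DQG programme is
# COVARIANT under unitary rotations of the one-particle basis

HONEST FRAMING (verbatim): certified bounds for a stated model Hamiltonian in a stated basis; not a
claim about the real molecule beyond that model.

Seat rdm-B, ROWS courtesy file (theorems only; no `def`, no notation). The 'NOT here: general one-body
unitary covariance' item of `Rows/OrbitalSignBlockingLossless(T).lean`, abstract part. For a square
matrix `U` on the spin-orbital index type `ι` with `U U† = 1` (hence `U† U = 1`), write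
`γ' = U γ U†`, `Γ' = (U ⊗ U) Γ (U ⊗ U)†` (`⊗` = Mathlib's Kronecker product `⊗ₖ` on `ι × ι`) — the
reduced density matrices of a state after the Bogoliubov lift of `U` (cf.
`ColemanOneMatrixRepresentability.oneRDM_Gamma_mulVec`), here for ABSTRACT pairs:

* `qMap_eq_kronecker` — Mazziotti's `Q`-map (eq. (14)) in Kronecker form,
  `Q(γ, Γ) = (1 − γᵀ ⊗ 1 − 1 ⊗ γᵀ)(1 − T) + Γᵀ` with `T` the pair-swap permutation matrix
  (`(1).submatrix id Prod.swap`); `gMap_eq_kronecker` — `G(γ, Γ) = γ ⊗ 1 − R(Γ)` with the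
  particle-hole reshuffle `R(Γ)_{(ij),(kl)} = Γ^{il}_{kj}`;
* **`qMap_conj_unitary`** — `Q(γ', Γ') = (Ū ⊗ Ū) Q(γ, Γ) (Ū ⊗ Ū)†` (`Ū` = entrywise conjugate; eq. (14)
  carries its arguments transposed); **`gMap_conj_unitary`** — `G(γ', Γ') = (U ⊗ Ū) G(γ, Γ) (U ⊗ Ū)†`
  (`reshuffle_conj`: the reshuffle re-pairs the four summation indices); both use `U U† = 1` only
  through the Kronecker-delta terms;
* `contract_conj` — the pair contraction is covariant, `Σ_j Γ'^{ij}_{kj} = (U C(Γ) U†)_{ik}` (uses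
  `U† U = 1`); `kronecker_mul_swap_fst`, `mul_kronecker_conjTranspose_swap_snd` — fermionic
  antisymmetry in either index pair survives;
* **`isDQGFeasible_conj_unitary`** — THE DQG-FEASIBLE SET IS INVARIANT: `IsDQGFeasible N γ Γ →
  IsDQGFeasible N γ' Γ'` (cones by congruence, `Matrix.PosSemidef.mul_mul_conjTranspose_same`; trace
  by cyclicity; contraction and antisymmetry as above).

The `S_z`-sector rows, the covariance of the energy functional (rotated integral tables) and the
invariance of the optimal values `E_PQG` are in `Rows/OrbitalRotationEnergy.lean` and
`Rows/OrbitalRotationInvariance.lean`. Special cases already in the tree: orbital RELABELLINGS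
(permutation matrices; the typer's `RelaxationSymmetryAveraging.lean`) and orbital SIGNS (diagonal
`±1`; `Rows/OrbitalSignBlockingLossless.lean`). Everything is PROVED (0 sorry, standard axioms); no
definitions, no named facts; nothing asserts a bound about any model; no claim node. NOT here: the
`T1`/`T2′` rung (the three-index functionals transform by `U ⊗ U ⊗ U` resp. `U ⊗ U ⊗ Ū`).

References: D. A. Mazziotti, in *Reduced-Density-Matrix Mechanics*, Adv. Chem. Phys. 134 (Wiley 2007)
ch. 3 §II.B eqs. (14)–(16); P. W. Ayers, E. R. Davidson, ibid. ch. 16 §III.F eqs. (56)–(57) (held copy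
PDF p. 462: "the (Q, R) conditions apply for any choice of the spin-orbital basis", the `Q`-matrix
transforming by `U_{a₁i₁}⋯U_{a_Qi_Q} Γ U_{j₁a₁}⋯U_{j_Qa_Q}` under a unitary change of spin orbitals).

Tree (REUSED): `qMap_apply`, `gMap_apply` (`OnePositivityFromTwoPositivity`), `IsDQGFeasible`
(`VariationalRDMRelaxation`). Mathlib: `Matrix.mul_kronecker_mul`, `Matrix.conjTranspose_kronecker`,
`Matrix.one_kronecker_one`, `Matrix.trace_mul_cycle`, `mul_eq_one_comm`,
`Matrix.PosSemidef.mul_mul_conjTranspose_same`, `Matrix.isHermitian_mul_mul_conjTranspose`,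
`Fintype.sum_equiv`.
-/

noncomputable section

namespace Summit.Ventures.CertifiedQuantumChemistry

open Matrix Finset
open Literature.MathematicalPhysics.QuantumLattice Literature.MathematicalPhysics.QuantumChemistry
open scoped ComplexOrder Kronecker

/-! ## §1 Matrix bookkeeping: entrywise conjugates, Kronecker squares and the pair swap -/

section Bookkeeping

variable {ι : Type*} [Fintype ι] [DecidableEq ι]

omit [Fintype ι] [DecidableEq ι] in
/-- The conjugate transpose of the entrywise conjugate is the transpose. -/
theorem conjTranspose_map_star (A : Matrix ι ι ℂ) : (A.map star)ᴴ = Aᵀ := by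
  ext i j
  simp only [conjTranspose_apply, map_apply, star_star, transpose_apply]

omit [Fintype ι] [DecidableEq ι] in
/-- The transpose of the conjugate transpose is the entrywise conjugate. -/
theorem transpose_conjTranspose_eq_map_star (A : Matrix ι ι ℂ) : Aᴴᵀ = A.map star := by
  ext i j
  simp only [conjTranspose_apply, map_apply, transpose_apply]

omit [DecidableEq ι] in
/-- Transpose of a congruence: `(B M Bᴴ)ᵀ = B̄ Mᵀ B̄ᴴ` with `B̄` the entrywise conjugate. -/
theorem transpose_conj (B M : Matrix ι ι ℂ) : (B * M * Bᴴ)ᵀ = B.map star * Mᵀ * (B.map star)ᴴ := by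
  rw [transpose_mul, transpose_mul, transpose_conjTranspose_eq_map_star, conjTranspose_map_star,
    Matrix.mul_assoc]

omit [DecidableEq ι] in
/-- `B̄ B̄ᴴ` is the entrywise conjugate of `B Bᴴ`. -/
theorem map_star_mul_conjTranspose_map_star (B : Matrix ι ι ℂ) :
    B.map star * (B.map star)ᴴ = (B * Bᴴ).map star := by
  ext i j
  simp only [mul_apply, map_apply, conjTranspose_apply, star_star, star_sum, star_mul']

/-- The entrywise conjugate of a co-isometry is a co-isometry. -/
theorem map_star_mul_conjTranspose_of_unitary {U : Matrix ι ι ℂ} (hU : U * Uᴴ = 1) :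
    U.map star * (U.map star)ᴴ = 1 := by
  rw [map_star_mul_conjTranspose_map_star, hU, Matrix.map_one star (star_zero ℂ) (star_one ℂ)]

omit [Fintype ι] [DecidableEq ι] in
/-- Entrywise conjugation distributes over the Kronecker product. -/
theorem kronecker_map_star (A B : Matrix ι ι ℂ) : (A ⊗ₖ B).map star = A.map star ⊗ₖ B.map star := by
  ext ⟨i, j⟩ ⟨k, l⟩
  simp only [map_apply, kroneckerMap_apply, star_mul']

/-- The Kronecker square of a co-isometry is a co-isometry. -/
theorem kronecker_mul_conjTranspose_of_unitary {U : Matrix ι ι ℂ} (hU : U * Uᴴ = 1) (V : Matrix ι ι ℂ)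
    (hV : V * Vᴴ = 1) : U ⊗ₖ V * (U ⊗ₖ V)ᴴ = 1 := by
  rw [conjTranspose_kronecker, ← mul_kronecker_mul, hU, hV, one_kronecker_one]

omit [Fintype ι] [DecidableEq ι] in
/-- A Kronecker square commutes with the pair swap: swapping its row pair is swapping its column
pair. -/
theorem kronecker_submatrix_swap (A : Matrix ι ι ℂ) :
    (A ⊗ₖ A).submatrix Prod.swap id = (A ⊗ₖ A).submatrix id Prod.swap := by
  ext ⟨i, j⟩ ⟨k, l⟩
  simp only [submatrix_apply, id, Prod.swap_prod_mk, kroneckerMap_apply, mul_comm]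

omit [DecidableEq ι] in
/-- Column reindexing passes through a product on the left factor's side. -/
theorem mul_submatrix_id (M N : Matrix (ι × ι) (ι × ι) ℂ) (e : ι × ι → ι × ι) :
    M * N.submatrix id e = (M * N).submatrix id e := by
  ext p q
  simp only [mul_apply, submatrix_apply, id]

omit [DecidableEq ι] in
/-- Moving a pair swap from the columns of the left factor to the rows of the right factor. -/
theorem submatrix_swap_mul (M N : Matrix (ι × ι) (ι × ι) ℂ) :
    M.submatrix id Prod.swap * N = M * N.submatrix Prod.swap id := by
  ext p q
  simp only [mul_apply, submatrix_apply, id]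
  exact Fintype.sum_equiv (Equiv.prodComm ι ι) _ _ fun r => by
    simp only [Equiv.prodComm_apply, Prod.swap_swap]

omit [DecidableEq ι] in
/-- **A Kronecker-square congruence commutes with the column pair swap.** -/
theorem conj_submatrix_swap (A : Matrix ι ι ℂ) (M : Matrix (ι × ι) (ι × ι) ℂ) :
    A ⊗ₖ A * M.submatrix id Prod.swap * (A ⊗ₖ A)ᴴ = (A ⊗ₖ A * M * (A ⊗ₖ A)ᴴ).submatrix id Prod.swap := by
  rw [mul_submatrix_id, submatrix_swap_mul, conjTranspose_kronecker, kronecker_submatrix_swap,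
    mul_submatrix_id]

/-- In particular the swap matrix itself is fixed by a unitary Kronecker-square congruence. -/
theorem conj_one_submatrix_swap {A : Matrix ι ι ℂ} (hA : A * Aᴴ = 1) :
    A ⊗ₖ A * (1 : Matrix (ι × ι) (ι × ι) ℂ).submatrix id Prod.swap * (A ⊗ₖ A)ᴴ =
      (1 : Matrix (ι × ι) (ι × ι) ℂ).submatrix id Prod.swap := by
  rw [conj_submatrix_swap, Matrix.mul_one, kronecker_mul_conjTranspose_of_unitary hA A hA]

/-- A Kronecker-square congruence of `M ⊗ₖ 1` by a co-isometry. -/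
theorem conj_kronecker_one {A : Matrix ι ι ℂ} (hA : A * Aᴴ = 1) (M : Matrix ι ι ℂ) :
    A ⊗ₖ A * M ⊗ₖ (1 : Matrix ι ι ℂ) * (A ⊗ₖ A)ᴴ = (A * M * Aᴴ) ⊗ₖ (1 : Matrix ι ι ℂ) := by
  rw [conjTranspose_kronecker, ← mul_kronecker_mul, ← mul_kronecker_mul, Matrix.mul_one, hA]

/-- A Kronecker-square congruence of `1 ⊗ₖ M` by a co-isometry. -/
theorem conj_one_kronecker {A : Matrix ι ι ℂ} (hA : A * Aᴴ = 1) (M : Matrix ι ι ℂ) :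
    A ⊗ₖ A * (1 : Matrix ι ι ℂ) ⊗ₖ M * (A ⊗ₖ A)ᴴ = (1 : Matrix ι ι ℂ) ⊗ₖ (A * M * Aᴴ) := by
  rw [conjTranspose_kronecker, ← mul_kronecker_mul, ← mul_kronecker_mul, Matrix.mul_one, hA]

omit [DecidableEq ι] in
/-- Entries of a triple product as a double sum (outer index adjacent to the right factor). -/
theorem mul_mul_apply {κ : Type*} [Fintype κ] (A : Matrix κ κ ℂ) (B : Matrix κ κ ℂ) (C : Matrix κ κ ℂ)
    (a b : κ) : (A * B * C) a b = ∑ x, ∑ y, A a y * B y x * C x b := by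
  simp only [mul_apply, Finset.sum_mul]

end Bookkeeping

/-! ## §2 The `Q`-map: structural formula and covariance -/

section QMap

variable {ι : Type*} [LinearOrder ι] [Fintype ι]

omit [Fintype ι] in
/-- **Structural form of Mazziotti's `Q`-map** (eq. (14)): with `T` the pair-swap permutation matrix,
`Q(γ, Γ) = 1 − T − γᵀ ⊗ 1 + (γᵀ ⊗ 1)·T + (1 ⊗ γᵀ)·T − 1 ⊗ γᵀ + Γᵀ`
(`= (1 − γᵀ ⊗ 1 − 1 ⊗ γᵀ)(1 − T) + Γᵀ`, the wedge products `2 ²I − 4 ¹D ∧ ¹I + ²D` written with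
Kronecker products; right multiplication by `T` = reindexing the column pair). -/
theorem qMap_eq_kronecker (γ : Matrix ι ι ℂ) (Γ : Matrix (ι × ι) (ι × ι) ℂ) :
    qMap γ Γ = 1 - (1 : Matrix (ι × ι) (ι × ι) ℂ).submatrix id Prod.swap - γᵀ ⊗ₖ (1 : Matrix ι ι ℂ) +
      (γᵀ ⊗ₖ (1 : Matrix ι ι ℂ)).submatrix id Prod.swap +
      ((1 : Matrix ι ι ℂ) ⊗ₖ γᵀ).submatrix id Prod.swap - (1 : Matrix ι ι ℂ) ⊗ₖ γᵀ + Γᵀ := by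
  ext ⟨i, j⟩ ⟨k, l⟩
  simp only [qMap_apply, Matrix.sub_apply, Matrix.add_apply, submatrix_apply, id, Prod.swap_prod_mk,
    kroneckerMap_apply, one_apply, transpose_apply, Prod.mk.injEq, ite_and, mul_ite, mul_one,
    mul_zero, ite_mul, one_mul, zero_mul]
  split_ifs <;> ring

/-- **The `Q`-map is covariant under a unitary rotation of the one-particle basis**:
`Q(UγU†, (U⊗U)Γ(U⊗U)†) = (Ū⊗Ū) Q(γ, Γ) (Ū⊗Ū)†` (`Ū` the entrywise conjugate; the conjugate
appears because eq. (14) carries `γ`, `Γ` transposed; for the cone `Q ⪰ 0` any congruence will do).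
Uses `U U† = 1` for the Kronecker-delta terms. -/
theorem qMap_conj_unitary {U : Matrix ι ι ℂ} (hU : U * Uᴴ = 1) (γ : Matrix ι ι ℂ)
    (Γ : Matrix (ι × ι) (ι × ι) ℂ) :
    qMap (U * γ * Uᴴ) (U ⊗ₖ U * Γ * (U ⊗ₖ U)ᴴ) =
      U.map star ⊗ₖ U.map star * qMap γ Γ * (U.map star ⊗ₖ U.map star)ᴴ := by
  have hV : U.map star * (U.map star)ᴴ = 1 := map_star_mul_conjTranspose_of_unitary hU
  have hVV : U.map star ⊗ₖ U.map star * (U.map star ⊗ₖ U.map star)ᴴ = 1 :=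
    kronecker_mul_conjTranspose_of_unitary hV _ hV
  rw [qMap_eq_kronecker, qMap_eq_kronecker, transpose_conj, transpose_conj (U ⊗ₖ U) Γ,
    kronecker_map_star]
  simp only [Matrix.mul_sub, Matrix.mul_add, Matrix.sub_mul, Matrix.add_mul]
  rw [Matrix.mul_one, hVV, conj_one_submatrix_swap hV, conj_submatrix_swap, conj_submatrix_swap,
    conj_kronecker_one hV, conj_one_kronecker hV]

end QMap

/-! ## §3 The `G`-map: structural formula and covariance -/

section GMap

variable {ι : Type*} [LinearOrder ι] [Fintype ι]

omit [Fintype ι] in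
/-- **Structural form of Mazziotti's `G`-map** (eq. (15)): `G(γ, Γ) = γ ⊗ 1 − R(Γ)` with the
particle-hole reshuffle `R(Γ)_{(ij),(kl)} = Γ^{il}_{kj}`. -/
theorem gMap_eq_kronecker (γ : Matrix ι ι ℂ) (Γ : Matrix (ι × ι) (ι × ι) ℂ) :
    gMap γ Γ = γ ⊗ₖ (1 : Matrix ι ι ℂ) - Matrix.of fun p q : ι × ι => Γ (p.1, q.2) (q.1, p.2) := by
  ext ⟨i, j⟩ ⟨k, l⟩
  simp only [gMap_apply, Matrix.sub_apply, kroneckerMap_apply, one_apply, Matrix.of_apply, mul_ite, mul_one,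
    mul_zero]

omit [LinearOrder ι] in
/-- **The particle-hole reshuffle is covariant**: `R((U⊗U)Γ(U⊗U)†) = (U⊗Ū) R(Γ) (U⊗Ū)†` — a pure
re-pairing of the four summation indices (no unitarity needed). -/
theorem reshuffle_conj (U : Matrix ι ι ℂ) (Γ : Matrix (ι × ι) (ι × ι) ℂ) :
    (Matrix.of fun p q : ι × ι => (U ⊗ₖ U * Γ * (U ⊗ₖ U)ᴴ) (p.1, q.2) (q.1, p.2)) =
      U ⊗ₖ U.map star * (Matrix.of fun p q : ι × ι => Γ (p.1, q.2) (q.1, p.2)) *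
        (U ⊗ₖ U.map star)ᴴ := by
  ext ⟨i, j⟩ ⟨k, l⟩
  rw [Matrix.of_apply, mul_mul_apply, mul_mul_apply, ← Fintype.sum_prod_type', ← Fintype.sum_prod_type']
  refine Fintype.sum_equiv ⟨fun z => ((z.1.1, z.2.2), (z.2.1, z.1.2)),
    fun z => ((z.1.1, z.2.2), (z.2.1, z.1.2)), fun _ => rfl, fun _ => rfl⟩ _ _ fun z => ?_
  simp only [Equiv.coe_fn_mk, Matrix.of_apply, conjTranspose_apply, kroneckerMap_apply, map_apply,
    star_mul', star_star]
  ring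

/-- **The `G`-map is covariant under a unitary rotation of the one-particle basis**:
`G(UγU†, (U⊗U)Γ(U⊗U)†) = (U⊗Ū) G(γ, Γ) (U⊗Ū)†`. Uses `U U† = 1` for the delta term. -/
theorem gMap_conj_unitary {U : Matrix ι ι ℂ} (hU : U * Uᴴ = 1) (γ : Matrix ι ι ℂ)
    (Γ : Matrix (ι × ι) (ι × ι) ℂ) :
    gMap (U * γ * Uᴴ) (U ⊗ₖ U * Γ * (U ⊗ₖ U)ᴴ) =
      U ⊗ₖ U.map star * gMap γ Γ * (U ⊗ₖ U.map star)ᴴ := by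
  have hV : U.map star * (U.map star)ᴴ = 1 := map_star_mul_conjTranspose_of_unitary hU
  rw [gMap_eq_kronecker, gMap_eq_kronecker, reshuffle_conj, Matrix.mul_sub, Matrix.sub_mul,
    conjTranspose_kronecker, ← mul_kronecker_mul, ← mul_kronecker_mul, Matrix.mul_one, hV,
    ← conjTranspose_kronecker]

end GMap

/-! ## §4 The linear rows: contraction, antisymmetry, trace -/

section Rows

variable {ι : Type*} [LinearOrder ι] [Fintype ι]

/-- **The pair contraction is covariant**: for `Γ' = (U⊗U) Γ (U⊗U)†` and `C(Γ)_{ac} = Σ_j Γ^{aj}_{cj}`,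
`Σ_j Γ'^{ij}_{kj} = (U C(Γ) U†)_{ik}`; uses `U†U = 1` (the contracted index pair is summed against
`Σ_j Ū_{jd} U_{jb} = δ_{db}`). -/
theorem contract_conj {U : Matrix ι ι ℂ} (hU' : Uᴴ * U = 1) (Γ : Matrix (ι × ι) (ι × ι) ℂ) (i k : ι) :
    ∑ j, (U ⊗ₖ U * Γ * (U ⊗ₖ U)ᴴ) (i, j) (k, j) =
      (U * (Matrix.of fun a c : ι => ∑ j, Γ (a, j) (c, j)) * Uᴴ) i k := by
  have hδ : ∀ b d : ι, ∑ j, star (U j d) * U j b = if d = b then 1 else 0 := by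
    intro b d
    have h := congr_fun (congr_fun hU' d) b
    simpa only [mul_apply, conjTranspose_apply, one_apply] using h
  calc ∑ j, (U ⊗ₖ U * Γ * (U ⊗ₖ U)ᴴ) (i, j) (k, j)
      = ∑ j, ∑ x, ∑ y, U i y.1 * Γ y x * star (U k x.1) * (star (U j x.2) * U j y.2) := by
        refine Finset.sum_congr rfl fun j _ => ?_
        rw [mul_mul_apply]
        refine Finset.sum_congr rfl fun x _ => Finset.sum_congr rfl fun y _ => ?_
        simp only [kroneckerMap_apply, conjTranspose_apply, star_mul']
        ring
    _ = ∑ x, ∑ y, U i y.1 * Γ y x * star (U k x.1) * ∑ j, star (U j x.2) * U j y.2 := by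
        rw [Finset.sum_comm]
        refine Finset.sum_congr rfl fun x _ => ?_
        rw [Finset.sum_comm]
        refine Finset.sum_congr rfl fun y _ => ?_
        rw [Finset.mul_sum]
    _ = ∑ x, ∑ y, U i y.1 * Γ y x * star (U k x.1) * (if x.2 = y.2 then 1 else 0) := by
        simp only [hδ]
    _ = ∑ c, ∑ a, ∑ b, U i a * Γ (a, b) (c, b) * star (U k c) := by
        rw [Fintype.sum_prod_type]
        refine Finset.sum_congr rfl fun c _ => ?_
        rw [Finset.sum_comm, Fintype.sum_prod_type]
        refine Finset.sum_congr rfl fun a _ => Finset.sum_congr rfl fun b _ => ?_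
        simp only [mul_ite, mul_one, mul_zero, Finset.sum_ite_eq', Finset.mem_univ, if_true]
    _ = (U * (Matrix.of fun a c : ι => ∑ j, Γ (a, j) (c, j)) * Uᴴ) i k := by
        rw [mul_mul_apply]
        refine Finset.sum_congr rfl fun c _ => Finset.sum_congr rfl fun a _ => ?_
        simp only [Matrix.of_apply, conjTranspose_apply, Finset.mul_sum, Finset.sum_mul]

omit [LinearOrder ι] in
/-- Antisymmetry in the row pair is preserved: if `Γ^{ji}_q = −Γ^{ij}_q` then the same holds for
`(U⊗U) Γ` (re-pair the summation over the row index of `Γ`). -/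
theorem kronecker_mul_swap_fst (U : Matrix ι ι ℂ) {Γ : Matrix (ι × ι) (ι × ι) ℂ}
    (hΓ : ∀ i j q, Γ (j, i) q = -Γ (i, j) q) (i j : ι) (q : ι × ι) :
    (U ⊗ₖ U * Γ) (j, i) q = -(U ⊗ₖ U * Γ) (i, j) q := by
  simp only [mul_apply, ← Finset.sum_neg_distrib]
  refine Fintype.sum_equiv (Equiv.prodComm ι ι) _ _ fun r => ?_
  obtain ⟨a, b⟩ := r
  simp only [Equiv.prodComm_apply, Prod.swap_prod_mk, kroneckerMap_apply, hΓ b a q]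
  ring

omit [LinearOrder ι] in
/-- Antisymmetry in the column pair is preserved: if `Γ_p^{lk} = −Γ_p^{kl}` then the same holds for
`Γ (U⊗U)†`. -/
theorem mul_kronecker_conjTranspose_swap_snd (U : Matrix ι ι ℂ) {Γ : Matrix (ι × ι) (ι × ι) ℂ}
    (hΓ : ∀ p k l, Γ p (l, k) = -Γ p (k, l)) (p : ι × ι) (k l : ι) :
    (Γ * (U ⊗ₖ U)ᴴ) p (l, k) = -(Γ * (U ⊗ₖ U)ᴴ) p (k, l) := by
  simp only [mul_apply, ← Finset.sum_neg_distrib]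
  refine Fintype.sum_equiv (Equiv.prodComm ι ι) _ _ fun r => ?_
  obtain ⟨a, b⟩ := r
  simp only [Equiv.prodComm_apply, Prod.swap_prod_mk, kroneckerMap_apply, conjTranspose_apply,
    hΓ p b a, star_mul']
  ring

/-! ## §5 Invariance of the DQG-feasible set -/

/-- **The DQG-feasible set is invariant under unitary rotations of the one-particle basis**
(`γ ↦ U γ U†`, `Γ ↦ (U⊗U) Γ (U⊗U)†`, `U U† = 1`): the three cones go to congruent cones
(`D` by `U⊗U`, `Q` by `Ū⊗Ū`, `G` by `U⊗Ū`), the trace and contraction rows are preserved by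
unitarity, antisymmetry by re-pairing. Mazziotti 2007 §II.B; Ayers–Davidson 2007 §III.F ("the
(Q, R) conditions apply for any choice of the spin-orbital basis"). -/
theorem isDQGFeasible_conj_unitary {U : Matrix ι ι ℂ} (hU : U * Uᴴ = 1) {N : ℕ} {γ : Matrix ι ι ℂ}
    {Γ : Matrix (ι × ι) (ι × ι) ℂ} (h : IsDQGFeasible N γ Γ) :
    IsDQGFeasible N (U * γ * Uᴴ) (U ⊗ₖ U * Γ * (U ⊗ₖ U)ᴴ) := by
  have hU' : Uᴴ * U = 1 := mul_eq_one_comm.mp hU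
  refine
    { herm_one := isHermitian_mul_mul_conjTranspose U h.herm_one
      d_psd := h.d_psd.mul_mul_conjTranspose_same _
      q_psd := ?_, g_psd := ?_, trace_one := ?_, contract := ?_, swap_fst := ?_, swap_snd := ?_ }
  · rw [qMap_conj_unitary hU]; exact h.q_psd.mul_mul_conjTranspose_same _
  · rw [gMap_conj_unitary hU]; exact h.g_psd.mul_mul_conjTranspose_same _
  · have ht : (U * γ * Uᴴ).trace = γ.trace := by rw [trace_mul_cycle, hU', Matrix.one_mul]
    have h1 := h.trace_one
    simp only [Matrix.trace, Matrix.diag] at ht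
    rw [ht]
    exact h1
  · intro i k
    have hC : (Matrix.of fun a c : ι => ∑ j, Γ (a, j) (c, j)) = ((N : ℂ) - 1) • γ := by
      ext a c
      rw [Matrix.of_apply, h.contract a c, Matrix.smul_apply, smul_eq_mul]
    rw [contract_conj hU', hC, Matrix.mul_smul, Matrix.smul_mul, Matrix.smul_apply, smul_eq_mul]
  · intro i j q
    rw [Matrix.mul_apply, Matrix.mul_apply, ← Finset.sum_neg_distrib]
    refine Finset.sum_congr rfl fun x _ => ?_
    rw [kronecker_mul_swap_fst U h.swap_fst, neg_mul]
  · intro p k l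
    rw [Matrix.mul_assoc, Matrix.mul_apply, Matrix.mul_apply, ← Finset.sum_neg_distrib]
    refine Finset.sum_congr rfl fun x _ => ?_
    rw [mul_kronecker_conjTranspose_swap_snd U h.swap_snd, mul_neg]

end Rows

end Summit.Ventures.CertifiedQuantumChemistry

end
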